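import Summits.KontsevichZagierPeriods.KontsevichZagierPeriods.Theorems.FurushoPentagonPentagonInKZCornerEngineExistAux
import Summits.KontsevichZagierPeriods.KontsevichZagierPeriods.Theorems.FurushoPentagonPentagonInKZCornerEngineExistEAux

/-!
# `PentagonInKZ`, line `edge-normal-newton-leibniz`: corner engine — existence of the edge representations

Part of the proof of `cornerEngine_uniformlyNull` (crux `FurushoPentagon.PentagonInKZ`,
stmt-KontsevichZagierPeriods-11348), in the ABSTRACT form of the corner engine: all objects (residues `Zq`,
residue monomials `wZ`, letter densities `fd`, `gd`, `dd`, regularised word integrands `Ht`, `Vt`,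
`dHt`, `dVt`, insertion operators `op`, `opV`, transports `Af`, `Bf`, `dAf`, `dBf`, defect `F`,
coordinate blocks `Xb | Yb | Θb`) are hypothesised, and their properties form ONE hypothesis
bundle `H`.  This file establishes the EXISTENCE of the two edge families of the engine (integral
representations on closed unit cubes: semialgebraic integrands, bounded on the cube):

* `abs_Af_sub_le`, `abs_Bf_sub_le` — the edge differences `A(ξ,η) − A(ξ,0)` and `B(ξ,η) − B(0,η)`
  are `O(ξ η)` on `[0,1]^k × [0,1]^l × [0,α] × [0,β]`;
* `normalise_weight` — the weight may be normalised to vanish where `Ξ Η = 0`;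
* `exists_RA_RB` — the two edge families `σ 𝔄`, `σ 𝔅` of the engine exist (bounded by a multiple
  of `|σ| Ξ Η` on the closed cube).

(The semialgebraicity tools, the plain bounds and the `O(ξ η)` bound for the defect are in
`…CornerEngineExistAux.lean`.)

References: [KontsevichZagier2001, §1.1–1.2], [BochnakCosteRoy1998, Prop. 2.2.6], [Drinfeld1991, §2].
-/

noncomputable section

open Set MeasureTheory
open Literature.NumberTheory.Transcendental
open Literature.ModelTheory.ExponentialFields (IsSemialgebraic)

namespace Summit.KontsevichZagierPeriods.FurushoPentagon.PentagonInKZ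

section AbstractEngine

variable {m N : ℕ} {ℓ ℓ' : Fin (m + 2)} {α β : ℚ}
  {Zq : Fin (m + 2) → (DrinfeldKohnoTrunc ℚ (Fin 4) N)} {wZ : ∀ {n : ℕ}, (Fin n → Fin (m + 2)) → (DrinfeldKohnoTrunc ℚ (Fin 4) N)}
  {fd gd dd : Fin (m + 2) → ℝ → ℝ → ℝ}
  {Ht Vt dHt dVt : ∀ {n : ℕ}, (Fin n → Fin (m + 2)) → (Fin n → ℝ) → ℝ → ℝ → ℝ}
  {op opV : Fin (m + 2) → (DrinfeldKohnoTrunc ℚ (Fin 4) N) →ₗ[ℚ] (DrinfeldKohnoTrunc ℚ (Fin 4) N)}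
  {Af Bf dAf dBf F : ((DrinfeldKohnoTrunc ℚ (Fin 4) N) →ₗ[ℚ] ℚ) → ∀ {k l : ℕ}, (Fin k → ℝ) → (Fin l → ℝ) → ℝ → ℝ → ℝ}
  {Xb : ∀ k l e : ℕ, (Fin (k + l + e) → ℝ) → Fin k → ℝ}
  {Yb : ∀ k l e : ℕ, (Fin (k + l + e) → ℝ) → Fin l → ℝ}
  {Θb : ∀ k l e : ℕ, (Fin (k + l + e) → ℝ) → Fin e → ℝ}

variable (H :
    (∀ {n : ℕ} (U : Fin n → Fin (m + 2)), wZ U = ((List.ofFn U).map Zq).prod) ∧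
    (∀ (a : Fin (m + 2)) (X : (DrinfeldKohnoTrunc ℚ (Fin 4) N)), op a X = if a = ℓ then Zq ℓ * X - X * Zq ℓ else Zq a * X) ∧
    (∀ (b : Fin (m + 2)) (X : (DrinfeldKohnoTrunc ℚ (Fin 4) N)), opV b X = if b = ℓ' then Zq ℓ' * X - X * Zq ℓ' else Zq b * X) ∧
    (∀ (μ : (DrinfeldKohnoTrunc ℚ (Fin 4) N) →ₗ[ℚ] ℚ) {k l : ℕ} (x : Fin k → ℝ) (y : Fin l → ℝ) (ξ η : ℝ), Af μ x y ξ η = ∑ U : Fin k → Fin (m + 2), ∑ V : Fin l → Fin (m + 2), (μ (wZ U * wZ V) : ℝ) * (Ht U x ξ η * Vt V y 0 η)) ∧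
    (∀ (μ : (DrinfeldKohnoTrunc ℚ (Fin 4) N) →ₗ[ℚ] ℚ) {k l : ℕ} (x : Fin k → ℝ) (y : Fin l → ℝ) (ξ η : ℝ), Bf μ x y ξ η = ∑ U : Fin k → Fin (m + 2), ∑ V : Fin l → Fin (m + 2), (μ (wZ V * wZ U) : ℝ) * (Vt V y ξ η * Ht U x ξ 0)) ∧
    (∀ (μ : (DrinfeldKohnoTrunc ℚ (Fin 4) N) →ₗ[ℚ] ℚ) {k l : ℕ} (x : Fin k → ℝ) (y : Fin l → ℝ) (ξ η : ℝ), dAf μ x y ξ η = ∑ U : Fin k → Fin (m + 2), ∑ V : Fin l → Fin (m + 2), (μ (wZ U * wZ V) : ℝ) * (dHt U x ξ η * Vt V y 0 η)) ∧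
    (∀ (μ : (DrinfeldKohnoTrunc ℚ (Fin 4) N) →ₗ[ℚ] ℚ) {k l : ℕ} (x : Fin k → ℝ) (y : Fin l → ℝ) (ξ η : ℝ), dBf μ x y ξ η = ∑ U : Fin k → Fin (m + 2), ∑ V : Fin l → Fin (m + 2), (μ (wZ V * wZ U) : ℝ) * (dVt V y ξ η * Ht U x ξ 0)) ∧
    (∀ (μ : (DrinfeldKohnoTrunc ℚ (Fin 4) N) →ₗ[ℚ] ℚ) {k l : ℕ} (x : Fin k → ℝ) (y : Fin l → ℝ) (ξ η : ℝ), F μ x y ξ η = Af μ x y ξ η - Bf μ x y ξ η) ∧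
    (∀ (k l e : ℕ) (z : Fin (k + l + e) → ℝ), Xb k l e z = fun i => z (Fin.castAdd e (Fin.castAdd l i))) ∧
    (∀ (k l e : ℕ) (z : Fin (k + l + e) → ℝ), Yb k l e z = fun j => z (Fin.castAdd e (Fin.natAdd k j))) ∧
    (∀ (k l e : ℕ) (z : Fin (k + l + e) → ℝ), Θb k l e z = fun s => z (Fin.natAdd (k + l) s)) ∧
    (∀ (U : Fin 0 → Fin (m + 2)) (x : Fin 0 → ℝ) (ξ η : ℝ), Ht U x ξ η = 1) ∧
    (∀ (V : Fin 0 → Fin (m + 2)) (y : Fin 0 → ℝ) (ξ η : ℝ), Vt V y ξ η = 1) ∧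
    (∀ (U : Fin 0 → Fin (m + 2)) (x : Fin 0 → ℝ) (ξ η : ℝ), dHt U x ξ η = 0) ∧
    (∀ (V : Fin 0 → Fin (m + 2)) (y : Fin 0 → ℝ) (ξ η : ℝ), dVt V y ξ η = 0) ∧
    (∀ {k : ℕ} (U : Fin (k + 1) → Fin (m + 2)) (x : Fin (k + 1) → ℝ) (η : ℝ), Ht U x 0 η = 0) ∧
    (∀ {l : ℕ} (V : Fin (l + 1) → Fin (m + 2)) (y : Fin (l + 1) → ℝ) (ξ : ℝ), Vt V y ξ 0 = 0) ∧
    (∀ t y : ℝ, fd ℓ t y = 1 / t) ∧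
    (∀ x s : ℝ, gd ℓ' x s = 1 / s) ∧
    (∀ x y : ℝ, dd ℓ x y = 0) ∧
    (∀ x y : ℝ, dd ℓ' x y = 0) ∧
    (∀ (μ : (DrinfeldKohnoTrunc ℚ (Fin 4) N) →ₗ[ℚ] ℚ) {k : ℕ} (x₀ : ℝ) (x' : Fin k → ℝ) (ξ η : ℝ), ∑ U : Fin (k + 1) → Fin (m + 2), (μ (wZ U) : ℝ) * Ht U (Fin.cons x₀ x') ξ η = (∑ a : Fin (m + 2), (if a = ℓ then 1 / x₀ else ξ * fd a (ξ * x₀) η) * ∑ U' : Fin k → Fin (m + 2), (μ (Zq a * wZ U') : ℝ) * Ht U' x' (ξ * x₀) η) - (1 / x₀) * ∑ U' : Fin k → Fin (m + 2), (μ (wZ U' * Zq ℓ) : ℝ) * Ht U' x' (ξ * x₀) η) ∧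
    (∀ (μ : (DrinfeldKohnoTrunc ℚ (Fin 4) N) →ₗ[ℚ] ℚ) {l : ℕ} (y₀ : ℝ) (y' : Fin l → ℝ) (ξ η : ℝ), ∑ V : Fin (l + 1) → Fin (m + 2), (μ (wZ V) : ℝ) * Vt V (Fin.cons y₀ y') ξ η = (∑ b : Fin (m + 2), (if b = ℓ' then 1 / y₀ else η * gd b ξ (η * y₀)) * ∑ V' : Fin l → Fin (m + 2), (μ (Zq b * wZ V') : ℝ) * Vt V' y' ξ (η * y₀)) - (1 / y₀) * ∑ V' : Fin l → Fin (m + 2), (μ (wZ V' * Zq ℓ') : ℝ) * Vt V' y' ξ (η * y₀)) ∧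
    (∀ (μ : (DrinfeldKohnoTrunc ℚ (Fin 4) N) →ₗ[ℚ] ℚ) {l : ℕ} (P Q : (DrinfeldKohnoTrunc ℚ (Fin 4) N)) (y : Fin l → ℝ) (η : ℝ), (∀ i, 0 < y i ∧ y i < 1) → 0 < η → η ≤ (β : ℝ) → ∑ V : Fin l → Fin (m + 2), (μ (P * (Zq ℓ * wZ V - wZ V * Zq ℓ) * Q) : ℝ) * Vt V y 0 η = 0) ∧
    (∀ (μ : (DrinfeldKohnoTrunc ℚ (Fin 4) N) →ₗ[ℚ] ℚ) {k : ℕ} (P Q : (DrinfeldKohnoTrunc ℚ (Fin 4) N)) (x : Fin k → ℝ) (ξ : ℝ), (∀ i, 0 < x i ∧ x i < 1) → 0 < ξ → ξ ≤ (α : ℝ) → ∑ U : Fin k → Fin (m + 2), (μ (P * (Zq ℓ' * wZ U - wZ U * Zq ℓ') * Q) : ℝ) * Ht U x ξ 0 = 0) ∧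
    (∀ (μ : (DrinfeldKohnoTrunc ℚ (Fin 4) N) →ₗ[ℚ] ℚ) (P Q : (DrinfeldKohnoTrunc ℚ (Fin 4) N)), μ (P * (Zq ℓ * Zq ℓ' - Zq ℓ' * Zq ℓ) * Q) = 0) ∧
    (∀ (μ : (DrinfeldKohnoTrunc ℚ (Fin 4) N) →ₗ[ℚ] ℚ) (P Q : (DrinfeldKohnoTrunc ℚ (Fin 4) N)) (x y : ℝ), 0 < x → x < (α : ℝ) → 0 < y → y < (β : ℝ) → ∑ a : Fin (m + 2), ∑ b : Fin (m + 2), (fd a x y * gd b x y) * (μ (P * (Zq a * Zq b - Zq b * Zq a) * Q) : ℝ) = 0) ∧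
    (∀ (μ : (DrinfeldKohnoTrunc ℚ (Fin 4) N) →ₗ[ℚ] ℚ) (P Q : (DrinfeldKohnoTrunc ℚ (Fin 4) N)) (s : ℝ), 0 < s → s < (β : ℝ) → ∑ b : Fin (m + 2), gd b 0 s * (μ (P * (Zq ℓ * Zq b - Zq b * Zq ℓ) * Q) : ℝ) = 0) ∧
    (∀ (μ : (DrinfeldKohnoTrunc ℚ (Fin 4) N) →ₗ[ℚ] ℚ) (P Q : (DrinfeldKohnoTrunc ℚ (Fin 4) N)) (t : ℝ), 0 < t → t < (α : ℝ) → ∑ a : Fin (m + 2), fd a t 0 * (μ (P * (Zq ℓ' * Zq a - Zq a * Zq ℓ') * Q) : ℝ) = 0) ∧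
    (∀ (a : Fin (m + 2)) (ξ η : ℝ), 0 ≤ ξ → ξ ≤ (α : ℝ) → 0 ≤ η → η ≤ (β : ℝ) → HasDerivAt (fun y => fd a ξ y) (dd a ξ η) η) ∧
    (∀ (b : Fin (m + 2)) (ξ η : ℝ), 0 ≤ ξ → ξ ≤ (α : ℝ) → 0 ≤ η → η ≤ (β : ℝ) → HasDerivAt (fun x => gd b x η) (dd b ξ η) ξ) ∧
    (∀ {k : ℕ} (U : Fin k → Fin (m + 2)) (x : Fin k → ℝ) (ξ η : ℝ), (∀ i, 0 ≤ x i ∧ x i ≤ 1) → 0 ≤ ξ → ξ ≤ (α : ℝ) → 0 ≤ η → η ≤ (β : ℝ) → HasDerivAt (fun t => Ht U x t η) (dHt U x ξ η) ξ) ∧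
    (∀ {l : ℕ} (V : Fin l → Fin (m + 2)) (y : Fin l → ℝ) (ξ η : ℝ), (∀ i, 0 ≤ y i ∧ y i ≤ 1) → 0 ≤ ξ → ξ ≤ (α : ℝ) → 0 ≤ η → η ≤ (β : ℝ) → HasDerivAt (fun s => Vt V y ξ s) (dVt V y ξ η) η) ∧
    (∀ {k : ℕ} (U : Fin (k + 1) → Fin (m + 2)) (x₀ : ℝ) (x' : Fin k → ℝ) (ξ η : ℝ), 0 < x₀ → x₀ < 1 → (∀ i, 0 ≤ x' i ∧ x' i ≤ 1) → 0 ≤ ξ → ξ ≤ (α : ℝ) → 0 ≤ η → η ≤ (β : ℝ) → HasDerivAt (fun t => t * Ht U (Fin.cons t x') ξ η) (ξ * dHt U (Fin.cons x₀ x') ξ η) x₀) ∧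
    (∀ {l : ℕ} (V : Fin (l + 1) → Fin (m + 2)) (y₀ : ℝ) (y' : Fin l → ℝ) (ξ η : ℝ), 0 < y₀ → y₀ < 1 → (∀ i, 0 ≤ y' i ∧ y' i ≤ 1) → 0 ≤ ξ → ξ ≤ (α : ℝ) → 0 ≤ η → η ≤ (β : ℝ) → HasDerivAt (fun t => t * Vt V (Fin.cons t y') ξ η) (η * dVt V (Fin.cons y₀ y') ξ η) y₀) ∧
    (∀ {k : ℕ} (U : Fin (k + 1) → Fin (m + 2)) (x' : Fin k → ℝ) (ξ η : ℝ), (∀ i, 0 ≤ x' i ∧ x' i ≤ 1) → 0 ≤ ξ → ξ ≤ (α : ℝ) → 0 ≤ η → η ≤ (β : ℝ) → ContinuousOn (fun t => t * Ht U (Fin.cons t x') ξ η) (Set.Icc 0 1)) ∧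
    (∀ {l : ℕ} (V : Fin (l + 1) → Fin (m + 2)) (y' : Fin l → ℝ) (ξ η : ℝ), (∀ i, 0 ≤ y' i ∧ y' i ≤ 1) → 0 ≤ ξ → ξ ≤ (α : ℝ) → 0 ≤ η → η ≤ (β : ℝ) → ContinuousOn (fun t => t * Vt V (Fin.cons t y') ξ η) (Set.Icc 0 1)) ∧
    (∀ {d : ℕ} {W : Set (Fin d → ℝ)}, IsSemialgebraic ℚ W → ∀ (a : Fin (m + 2)) {T Y : (Fin d → ℝ) → ℝ}, IsSemialgebraicFunOn ℚ W T → IsSemialgebraicFunOn ℚ W Y → IsSemialgebraicFunOn ℚ W fun z => fd a (T z) (Y z)) ∧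
    (∀ {d : ℕ} {W : Set (Fin d → ℝ)}, IsSemialgebraic ℚ W → ∀ (b : Fin (m + 2)) {T Y : (Fin d → ℝ) → ℝ}, IsSemialgebraicFunOn ℚ W T → IsSemialgebraicFunOn ℚ W Y → IsSemialgebraicFunOn ℚ W fun z => gd b (T z) (Y z)) ∧
    (∀ {d : ℕ} {W : Set (Fin d → ℝ)}, IsSemialgebraic ℚ W → ∀ (a : Fin (m + 2)) {T Y : (Fin d → ℝ) → ℝ}, IsSemialgebraicFunOn ℚ W T → IsSemialgebraicFunOn ℚ W Y → IsSemialgebraicFunOn ℚ W fun z => dd a (T z) (Y z)) ∧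
    (∀ {d : ℕ} {W : Set (Fin d → ℝ)}, IsSemialgebraic ℚ W → ∀ {n : ℕ} (U : Fin n → Fin (m + 2)) {X : (Fin d → ℝ) → Fin n → ℝ} {P Q : (Fin d → ℝ) → ℝ}, (∀ i, IsSemialgebraicFunOn ℚ W fun z => X z i) → IsSemialgebraicFunOn ℚ W P → IsSemialgebraicFunOn ℚ W Q → IsSemialgebraicFunOn ℚ W fun z => Ht U (X z) (P z) (Q z)) ∧
    (∀ {d : ℕ} {W : Set (Fin d → ℝ)}, IsSemialgebraic ℚ W → ∀ {n : ℕ} (V : Fin n → Fin (m + 2)) {Y : (Fin d → ℝ) → Fin n → ℝ} {P Q : (Fin d → ℝ) → ℝ}, (∀ i, IsSemialgebraicFunOn ℚ W fun z => Y z i) → IsSemialgebraicFunOn ℚ W P → IsSemialgebraicFunOn ℚ W Q → IsSemialgebraicFunOn ℚ W fun z => Vt V (Y z) (P z) (Q z)) ∧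
    (∀ {d : ℕ} {W : Set (Fin d → ℝ)}, IsSemialgebraic ℚ W → ∀ {n : ℕ} (U : Fin n → Fin (m + 2)) {X : (Fin d → ℝ) → Fin n → ℝ} {P Q : (Fin d → ℝ) → ℝ}, (∀ i, IsSemialgebraicFunOn ℚ W fun z => X z i) → IsSemialgebraicFunOn ℚ W P → IsSemialgebraicFunOn ℚ W Q → IsSemialgebraicFunOn ℚ W fun z => dHt U (X z) (P z) (Q z)) ∧
    (∀ {d : ℕ} {W : Set (Fin d → ℝ)}, IsSemialgebraic ℚ W → ∀ {n : ℕ} (V : Fin n → Fin (m + 2)) {Y : (Fin d → ℝ) → Fin n → ℝ} {P Q : (Fin d → ℝ) → ℝ}, (∀ i, IsSemialgebraicFunOn ℚ W fun z => Y z i) → IsSemialgebraicFunOn ℚ W P → IsSemialgebraicFunOn ℚ W Q → IsSemialgebraicFunOn ℚ W fun z => dVt V (Y z) (P z) (Q z)) ∧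
    (∃ C : ℝ, ∀ (a : Fin (m + 2)) (ξ η : ℝ), 0 ≤ ξ → ξ ≤ (α : ℝ) → 0 ≤ η → η ≤ (β : ℝ) → (a ≠ ℓ → |fd a ξ η| ≤ C) ∧ (a ≠ ℓ' → |gd a ξ η| ≤ C) ∧ |dd a ξ η| ≤ C ∧ (∀ η' : ℝ, 0 ≤ η' → η' ≤ (β : ℝ) → |fd a ξ η - fd a ξ η'| ≤ C * |η - η'|) ∧ (∀ ξ' : ℝ, 0 ≤ ξ' → ξ' ≤ (α : ℝ) → |gd a ξ η - gd a ξ' η| ≤ C * |ξ - ξ'|)) ∧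
    (∀ k : ℕ, ∃ C : ℝ, ∀ (U : Fin k → Fin (m + 2)) (x : Fin k → ℝ) (ξ η : ℝ), (∀ i, 0 ≤ x i ∧ x i ≤ 1) → 0 ≤ ξ → ξ ≤ (α : ℝ) → 0 ≤ η → η ≤ (β : ℝ) → |Ht U x ξ η| ≤ C ∧ |dHt U x ξ η| ≤ C ∧ (0 < k → |Ht U x ξ η| ≤ C * ξ) ∧ (∀ η' : ℝ, 0 ≤ η' → η' ≤ (β : ℝ) → |Ht U x ξ η - Ht U x ξ η'| ≤ C * ξ * |η - η'|)) ∧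
    (∀ l : ℕ, ∃ C : ℝ, ∀ (V : Fin l → Fin (m + 2)) (y : Fin l → ℝ) (ξ η : ℝ), (∀ i, 0 ≤ y i ∧ y i ≤ 1) → 0 ≤ ξ → ξ ≤ (α : ℝ) → 0 ≤ η → η ≤ (β : ℝ) → |Vt V y ξ η| ≤ C ∧ |dVt V y ξ η| ≤ C ∧ (0 < l → |Vt V y ξ η| ≤ C * η) ∧ (∀ ξ' : ℝ, 0 ≤ ξ' → ξ' ≤ (α : ℝ) → |Vt V y ξ η - Vt V y ξ' η| ≤ C * η * |ξ - ξ'|)))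

/-! ### The edge differences are `O(ξ η)` -/

include H in
/-- **The edge difference `A(ξ,η) − A(ξ,0)` is `O(ξ η)`** (horizontal block nonempty). [folklore] -/
theorem abs_Af_sub_le (μ : (DrinfeldKohnoTrunc ℚ (Fin 4) N) →ₗ[ℚ] ℚ) (k l : ℕ) :
    ∃ K : ℝ, 0 ≤ K ∧ ∀ (x : Fin (k + 1) → ℝ) (y : Fin l → ℝ) (ξ η : ℝ), (∀ i, 0 ≤ x i ∧ x i ≤ 1) →
      (∀ j, 0 ≤ y j ∧ y j ≤ 1) → 0 ≤ ξ → ξ ≤ (α : ℝ) → 0 ≤ η → η ≤ (β : ℝ) →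
      |Af μ x y ξ η - Af μ x y ξ 0| ≤ K * ξ * η := by
  obtain ⟨_, _, _, hAf, _, _, _, _, _, _, _, _, hVt_nil, _, _, _, hVt_zero, _, _, _, _, _, _, _, _, _, _, _, _, _,
    _, _, _, _, _, _, _, _, _, _, _, _, _, _, _, hbd_Ht, hbd_Vt⟩ := H
  obtain ⟨CH, hCH⟩ := hbd_Ht (k + 1)
  obtain ⟨CV, hCV⟩ := hbd_Vt l
  refine ⟨(∑ U : Fin (k + 1) → Fin (m + 2), ∑ V : Fin l → Fin (m + 2), |(μ (wZ U * wZ V) : ℝ)|) *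
      (|CH| * (|CV| + 1)), by positivity, fun x y ξ η hx hy hξ0 hξα hη0 hηβ => ?_⟩
  have hCV1 : |CH| ≤ |CH| * (|CV| + 1) :=
    le_mul_of_one_le_right (abs_nonneg _) (le_add_of_nonneg_left (abs_nonneg _))
  have hrew : Af μ x y ξ η - Af μ x y ξ 0 = ∑ U : Fin (k + 1) → Fin (m + 2), ∑ V : Fin l → Fin (m + 2),
      (μ (wZ U * wZ V) : ℝ) * (Ht U x ξ η * Vt V y 0 η - Ht U x ξ 0 * Vt V y 0 0) := by
    rw [hAf, hAf]
    simp only [← Finset.sum_sub_distrib, mul_sub]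
  rw [hrew]
  refine (abs_sum_sum_mul_le _ _ (fun U V => (μ (wZ U * wZ V) : ℝ))
    (fun U V => Ht U x ξ η * Vt V y 0 η - Ht U x ξ 0 * Vt V y 0 0) (|CH| * (|CV| + 1) * ξ * η)
    fun U _ V _ => ?_).trans (le_of_eq (by ring))
  have hβ0 : (0 : ℝ) ≤ β := hη0.trans hηβ
  have hα0 : (0 : ℝ) ≤ α := hξ0.trans hξα
  rcases Nat.eq_zero_or_pos l with rfl | hl
  · -- `Vt ≡ 1`: transverse Lipschitz bound of `Ht`
    have h := (hCH U x ξ η hx hξ0 hξα hη0 hηβ).2.2.2 0 le_rfl hβ0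
    rw [sub_zero, abs_of_nonneg hη0] at h
    show |Ht U x ξ η * Vt V y 0 η - Ht U x ξ 0 * Vt V y 0 0| ≤ _
    rw [hVt_nil, hVt_nil, mul_one, mul_one]
    exact h.trans (mul_le_mul_of_nonneg_right (mul_le_mul_of_nonneg_right hCV1 hξ0) hη0 |>.trans'
      (mul_le_mul_of_nonneg_right (mul_le_mul_of_nonneg_right (le_abs_self _) hξ0) hη0))
  · -- `Vt(0,0) = 0`: `|Ht| ≤ C ξ` and `|Vt(0,η)| ≤ C η`
    obtain ⟨l', rfl⟩ : ∃ l', l = l' + 1 := ⟨l - 1, by omega⟩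
    show |Ht U x ξ η * Vt V y 0 η - Ht U x ξ 0 * Vt V y 0 0| ≤ _
    rw [hVt_zero, mul_zero, sub_zero, abs_mul]
    have h1 : |Ht U x ξ η| ≤ |CH| * ξ := ((hCH U x ξ η hx hξ0 hξα hη0 hηβ).2.2.1 (Nat.succ_pos k)).trans
      (mul_le_mul_of_nonneg_right (le_abs_self _) hξ0)
    have h2 : |Vt V y 0 η| ≤ |CV| * η := ((hCV V y 0 η hy le_rfl hα0 hη0 hηβ).2.2.1 (Nat.succ_pos l')).trans
      (mul_le_mul_of_nonneg_right (le_abs_self _) hη0)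
    calc |Ht U x ξ η| * |Vt V y 0 η| ≤ (|CH| * ξ) * (|CV| * η) := mul_le_mul h1 h2 (abs_nonneg _) (by positivity)
      _ ≤ (|CH| * ξ) * ((|CV| + 1) * η) :=
        mul_le_mul_of_nonneg_left (mul_le_mul_of_nonneg_right (le_add_of_nonneg_right zero_le_one) hη0)
          (by positivity)
      _ = |CH| * (|CV| + 1) * ξ * η := by ring

include H in
/-- **The edge difference `B(ξ,η) − B(0,η)` is `O(ξ η)`** (vertical block nonempty). [folklore] -/
theorem abs_Bf_sub_le (μ : (DrinfeldKohnoTrunc ℚ (Fin 4) N) →ₗ[ℚ] ℚ) (k l : ℕ) :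
    ∃ K : ℝ, 0 ≤ K ∧ ∀ (x : Fin k → ℝ) (y : Fin (l + 1) → ℝ) (ξ η : ℝ), (∀ i, 0 ≤ x i ∧ x i ≤ 1) →
      (∀ j, 0 ≤ y j ∧ y j ≤ 1) → 0 ≤ ξ → ξ ≤ (α : ℝ) → 0 ≤ η → η ≤ (β : ℝ) →
      |Bf μ x y ξ η - Bf μ x y 0 η| ≤ K * ξ * η := by
  obtain ⟨_, _, _, _, hBf, _, _, _, _, _, _, hHt_nil, _, _, _, hHt_zero, _, _, _, _, _, _, _, _, _, _, _, _, _, _,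
    _, _, _, _, _, _, _, _, _, _, _, _, _, _, _, hbd_Ht, hbd_Vt⟩ := H
  obtain ⟨CH, hCH⟩ := hbd_Ht k
  obtain ⟨CV, hCV⟩ := hbd_Vt (l + 1)
  refine ⟨(∑ U : Fin k → Fin (m + 2), ∑ V : Fin (l + 1) → Fin (m + 2), |(μ (wZ V * wZ U) : ℝ)|) *
      (|CV| * (|CH| + 1)), by positivity, fun x y ξ η hx hy hξ0 hξα hη0 hηβ => ?_⟩
  have hCH1 : |CV| ≤ |CV| * (|CH| + 1) :=
    le_mul_of_one_le_right (abs_nonneg _) (le_add_of_nonneg_left (abs_nonneg _))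
  have hrew : Bf μ x y ξ η - Bf μ x y 0 η = ∑ U : Fin k → Fin (m + 2), ∑ V : Fin (l + 1) → Fin (m + 2),
      (μ (wZ V * wZ U) : ℝ) * (Vt V y ξ η * Ht U x ξ 0 - Vt V y 0 η * Ht U x 0 0) := by
    rw [hBf, hBf]
    simp only [← Finset.sum_sub_distrib, mul_sub]
  rw [hrew]
  refine (abs_sum_sum_mul_le _ _ (fun U V => (μ (wZ V * wZ U) : ℝ))
    (fun U V => Vt V y ξ η * Ht U x ξ 0 - Vt V y 0 η * Ht U x 0 0) (|CV| * (|CH| + 1) * ξ * η)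
    fun U _ V _ => ?_).trans (le_of_eq (by ring))
  have hβ0 : (0 : ℝ) ≤ β := hη0.trans hηβ
  have hα0 : (0 : ℝ) ≤ α := hξ0.trans hξα
  rcases Nat.eq_zero_or_pos k with rfl | hk
  · -- `Ht ≡ 1`: Lipschitz bound of `Vt` in `ξ`
    have h := (hCV V y ξ η hy hξ0 hξα hη0 hηβ).2.2.2 0 le_rfl hα0
    rw [sub_zero, abs_of_nonneg hξ0] at h
    show |Vt V y ξ η * Ht U x ξ 0 - Vt V y 0 η * Ht U x 0 0| ≤ _
    rw [hHt_nil, hHt_nil, mul_one, mul_one]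
    calc |Vt V y ξ η - Vt V y 0 η| ≤ CV * η * ξ := h
      _ ≤ |CV| * (|CH| + 1) * η * ξ := mul_le_mul_of_nonneg_right
          (mul_le_mul_of_nonneg_right ((le_abs_self _).trans hCH1) hη0) hξ0
      _ = |CV| * (|CH| + 1) * ξ * η := by ring
  · -- `Ht(0,0) = 0`: `|Vt| ≤ C η` and `|Ht(ξ,0)| ≤ C ξ`
    obtain ⟨k', rfl⟩ : ∃ k', k = k' + 1 := ⟨k - 1, by omega⟩
    show |Vt V y ξ η * Ht U x ξ 0 - Vt V y 0 η * Ht U x 0 0| ≤ _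
    rw [hHt_zero, mul_zero, sub_zero, abs_mul]
    have h1 : |Vt V y ξ η| ≤ |CV| * η := ((hCV V y ξ η hy hξ0 hξα hη0 hηβ).2.2.1 (Nat.succ_pos l)).trans
      (mul_le_mul_of_nonneg_right (le_abs_self _) hη0)
    have h2 : |Ht U x ξ 0| ≤ |CH| * ξ := ((hCH U x ξ 0 hx hξ0 hξα le_rfl hβ0).2.2.1 (Nat.succ_pos k')).trans
      (mul_le_mul_of_nonneg_right (le_abs_self _) hξ0)
    calc |Vt V y ξ η| * |Ht U x ξ 0| ≤ (|CV| * η) * (|CH| * ξ) := mul_le_mul h1 h2 (abs_nonneg _) (by positivity)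
      _ ≤ (|CV| * η) * ((|CH| + 1) * ξ) :=
        mul_le_mul_of_nonneg_left (mul_le_mul_of_nonneg_right (le_add_of_nonneg_right zero_le_one) hξ0)
          (by positivity)
      _ = |CV| * (|CH| + 1) * ξ * η := by ring

/-! ### Normalisation of the weight -/

/-- **Normalising the weight**: replacing `σ` by `σ · 1[Ξ ≠ 0] · 1[Η ≠ 0]` changes no integrand
`σ F(Ξ, Η)` (the defect vanishes on the axes), keeps semialgebraicity and the admissibility bound.
[folklore] -/
theorem normalise_weight (e : ℕ) (Ξ Η σ : (Fin e → ℝ) → ℝ)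
    (hsaΞ : IsSemialgebraicFunOn ℚ (KZ.cube e) Ξ) (hsaΗ : IsSemialgebraicFunOn ℚ (KZ.cube e) Η)
    (hsaσ : IsSemialgebraicFunOn ℚ (KZ.cube e) σ) (hb : ∃ C : ℝ, ∀ θ ∈ KZ.cube e, |σ θ| * Ξ θ * Η θ ≤ C) :
    ∃ σ' : (Fin e → ℝ) → ℝ, IsSemialgebraicFunOn ℚ (KZ.cube e) σ' ∧
      (∃ C : ℝ, ∀ θ ∈ KZ.cube e, |σ' θ| * Ξ θ * Η θ ≤ C) ∧
      (∀ θ ∈ KZ.cube e, Ξ θ = 0 ∨ Η θ = 0 → σ' θ = 0) ∧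
      (∀ θ ∈ KZ.cube e, Ξ θ ≠ 0 → Η θ ≠ 0 → σ' θ = σ θ) := by
  classical
  obtain ⟨C, hC⟩ := hb
  obtain ⟨σ', hσ'⟩ : ∃ σ' : (Fin e → ℝ) → ℝ, ∀ θ, σ' θ = if Ξ θ = 0 ∨ Η θ = 0 then 0 else σ θ :=
    ⟨_, fun _ => rfl⟩
  -- the zero locus `Z = {Ξ = 0} ∪ {Η = 0}` inside the cube and its complement are semialgebraic
  set Z : Set (Fin e → ℝ) := {θ | θ ∈ KZ.cube e ∧ Ξ θ = 0} ∪ {θ | θ ∈ KZ.cube e ∧ Η θ = 0} with hZ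
  have hZsa : IsSemialgebraic ℚ Z :=
    (isSemialgebraic_sep_eq hsaΞ (sa_zero KZ.isSemialgebraic_cube)).union
      (isSemialgebraic_sep_eq hsaΗ (sa_zero KZ.isSemialgebraic_cube))
  have hZsub : Z ⊆ KZ.cube e := fun θ hθ => hθ.elim (fun h => h.1) fun h => h.1
  have hmemZ : ∀ θ ∈ KZ.cube e, (θ ∈ Z ↔ Ξ θ = 0 ∨ Η θ = 0) := fun θ hθ =>
    ⟨fun h => h.elim (fun h => Or.inl h.2) fun h => Or.inr h.2,
      fun h => h.elim (fun h => Or.inl ⟨hθ, h⟩) fun h => Or.inr ⟨hθ, h⟩⟩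
  refine ⟨σ', ?_, ⟨max C 0, fun θ hθ => ?_⟩, fun θ hθ h => ?_, fun θ hθ h1 h2 => ?_⟩
  · have key : IsSemialgebraicFunOn ℚ (Z ∪ KZ.cube e \ Z) σ' := by
      refine IsSemialgebraicFunOn.union (sa_zero hZsa) (hsaσ.mono Set.sdiff_subset (KZ.isSemialgebraic_cube.diff hZsa))
        (fun θ hθ => ?_) fun θ hθ => ?_
      · rw [hσ', if_pos ((hmemZ θ (hZsub hθ)).1 hθ)]
      · rw [hσ', if_neg fun h => hθ.2 ((hmemZ θ hθ.1).2 h)]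
    rwa [Set.union_sdiff_cancel hZsub] at key
  · by_cases h : Ξ θ = 0 ∨ Η θ = 0
    · rw [hσ', if_pos h, abs_zero, zero_mul, zero_mul]; exact le_max_right _ _
    · rw [hσ', if_neg h]; exact (hC θ hθ).trans (le_max_left _ _)
  · rw [hσ', if_pos h]
  · rw [hσ', if_neg (not_or.2 ⟨h1, h2⟩)]

/-! ### Existence of the two edge families -/

include H in
/-- **The two edge families exist**: `σ 𝔄 = σ [A(Ξ,Η) − A(Ξ,0)]` (degree `(k+1, l)`) and
`σ 𝔅 = σ [B(Ξ,Η) − B(0,Η)]` (degree `(k, l+1)`) are bounded on the closed cube by a multiple of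
`|σ| Ξ Η`. [folklore] -/
theorem exists_RA_RB (μ : (DrinfeldKohnoTrunc ℚ (Fin 4) N) →ₗ[ℚ] ℚ) (e : ℕ) (Ξ Η σ : (Fin e → ℝ) → ℝ)
    (hΞΗ : ∀ θ ∈ KZ.cube e, 0 ≤ Ξ θ ∧ Ξ θ ≤ (α : ℝ) ∧ 0 ≤ Η θ ∧ Η θ ≤ (β : ℝ))
    (hsaΞ : IsSemialgebraicFunOn ℚ (KZ.cube e) Ξ) (hsaΗ : IsSemialgebraicFunOn ℚ (KZ.cube e) Η)
    (hsaσ : IsSemialgebraicFunOn ℚ (KZ.cube e) σ) (hb : ∃ C : ℝ, ∀ θ ∈ KZ.cube e, |σ θ| * Ξ θ * Η θ ≤ C) (k l : ℕ) :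
    (∃ RA : KZ.IntegralRep (k + 1 + l + e), RA.domain = KZ.cube (k + 1 + l + e) ∧
      RA.integrand = fun z => σ (Θb (k + 1) l e z) *
        (Af μ (Xb (k + 1) l e z) (Yb (k + 1) l e z) (Ξ (Θb (k + 1) l e z)) (Η (Θb (k + 1) l e z)) -
          Af μ (Xb (k + 1) l e z) (Yb (k + 1) l e z) (Ξ (Θb (k + 1) l e z)) 0)) ∧
    (∃ RB : KZ.IntegralRep (k + (l + 1) + e), RB.domain = KZ.cube (k + (l + 1) + e) ∧
      RB.integrand = fun z => σ (Θb k (l + 1) e z) *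
        (Bf μ (Xb k (l + 1) e z) (Yb k (l + 1) e z) (Ξ (Θb k (l + 1) e z)) (Η (Θb k (l + 1) e z)) -
          Bf μ (Xb k (l + 1) e z) (Yb k (l + 1) e z) 0 (Η (Θb k (l + 1) e z)))) := by
  obtain ⟨C₀, hC₀⟩ := hb
  have h0 := fun d => sa_zero (KZ.isSemialgebraic_cube (n := d))
  refine ⟨?_, ?_⟩
  · obtain ⟨K, hK0, hK⟩ := abs_Af_sub_le H μ k l
    refine CornerReps.exists_rep_cube _ ((sa_Θb H hsaσ).fun_mul
      ((sa_Af H KZ.isSemialgebraic_cube μ (sa_Xb H) (sa_Yb H) (sa_Θb H hsaΞ) (sa_Θb H hsaΗ)).fun_sub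
        (sa_Af H KZ.isSemialgebraic_cube μ (sa_Xb H) (sa_Yb H) (sa_Θb H hsaΞ) (h0 _))))
      ⟨K * C₀, fun z hz => ?_⟩
    obtain ⟨hx, hy, hθ⟩ := Xb_Yb_Θb_mem H hz
    obtain ⟨hΞ0, hΞα, hΗ0, hΗβ⟩ := hΞΗ _ hθ
    rw [abs_mul]
    calc _ ≤ |σ (Θb (k + 1) l e z)| * (K * Ξ (Θb (k + 1) l e z) * Η (Θb (k + 1) l e z)) :=
        mul_le_mul_of_nonneg_left (hK _ _ _ _ hx hy hΞ0 hΞα hΗ0 hΗβ) (abs_nonneg _)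
      _ = K * (|σ (Θb (k + 1) l e z)| * Ξ (Θb (k + 1) l e z) * Η (Θb (k + 1) l e z)) := by ring
      _ ≤ K * C₀ := mul_le_mul_of_nonneg_left (hC₀ _ hθ) hK0
  · obtain ⟨K, hK0, hK⟩ := abs_Bf_sub_le H μ k l
    refine CornerReps.exists_rep_cube _ ((sa_Θb H hsaσ).fun_mul
      ((qe_sa_Bf H KZ.isSemialgebraic_cube μ (sa_Xb H) (sa_Yb H) (sa_Θb H hsaΞ) (sa_Θb H hsaΗ)).fun_sub
        (qe_sa_Bf H KZ.isSemialgebraic_cube μ (sa_Xb H) (sa_Yb H) (h0 _) (sa_Θb H hsaΗ))))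
      ⟨K * C₀, fun z hz => ?_⟩
    obtain ⟨hx, hy, hθ⟩ := Xb_Yb_Θb_mem H hz
    obtain ⟨hΞ0, hΞα, hΗ0, hΗβ⟩ := hΞΗ _ hθ
    rw [abs_mul]
    calc _ ≤ |σ (Θb k (l + 1) e z)| * (K * Ξ (Θb k (l + 1) e z) * Η (Θb k (l + 1) e z)) :=
        mul_le_mul_of_nonneg_left (hK _ _ _ _ hx hy hΞ0 hΞα hΗ0 hΗβ) (abs_nonneg _)
      _ = K * (|σ (Θb k (l + 1) e z)| * Ξ (Θb k (l + 1) e z) * Η (Θb k (l + 1) e z)) := by ring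
      _ ≤ K * C₀ := mul_le_mul_of_nonneg_left (hC₀ _ hθ) hK0

end AbstractEngine

/-- **Hook `cornerEngineExist_normalise_weight`** (registered form of `normalise_weight`): a weight
`σ` on `[0,1]^e` may be replaced by `σ · 1[Ξ ≠ 0] · 1[Η ≠ 0]` keeping semialgebraicity and the
bound on `|σ| Ξ Η`. [cite: BochnakCosteRoy1998, Thm. 2.2.1] -/
theorem cornerEngineExist_normalise_weight : ∀ (e : ℕ) (Ξ Η σ : (Fin e → ℝ) → ℝ), Literature.NumberTheory.Transcendental.IsSemialgebraicFunOn ℚ (Literature.NumberTheory.Transcendental.KZ.cube e) Ξ → Literature.NumberTheory.Transcendental.IsSemialgebraicFunOn ℚ (Literature.NumberTheory.Transcendental.KZ.cube e) Η → Literature.NumberTheory.Transcendental.IsSemialgebraicFunOn ℚ (Literature.NumberTheory.Transcendental.KZ.cube e) σ → (∃ C : ℝ, ∀ θ ∈ Literature.NumberTheory.Transcendental.KZ.cube e, |σ θ| * Ξ θ * Η θ ≤ C) → ∃ σ' : (Fin e → ℝ) → ℝ, Literature.NumberTheory.Transcendental.IsSemialgebraicFunOn ℚ (Literature.NumberTheory.Transcendental.KZ.cube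 e) σ' ∧ (∃ C : ℝ, ∀ θ ∈ Literature.NumberTheory.Transcendental.KZ.cube e, |σ' θ| * Ξ θ * Η θ ≤ C) ∧ (∀ θ ∈ Literature.NumberTheory.Transcendental.KZ.cube e, Ξ θ = 0 ∨ Η θ = 0 → σ' θ = 0) ∧ (∀ θ ∈ Literature.NumberTheory.Transcendental.KZ.cube e, Ξ θ ≠ 0 → Η θ ≠ 0 → σ' θ = σ θ) :=
  fun e Ξ Η σ hΞ hΗ hσ hb => normalise_weight e Ξ Η σ hΞ hΗ hσ hb

end Summit.KontsevichZagierPeriods.FurushoPentagon.PentagonInKZ
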